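import Literature.AnabelianGeometry.SemiGraphs.FiniteEtaleCoveringGlobalHolds
import HarnessLib

/-!
# Sub-coverticial edges from an object of `B(𝒢)` with connected vertex constituents ([SemiAnbd] Def. 2.4 (iii))

Mochizuki, *Semi-graphs of anabelioids*, Publ. RIMS **42** (2006), Def. 2.2 (i) p. 23 (the finite étale
covering `𝒢_A → 𝒢` attached to an object `A = {S_v, T_e, ψ_b}` of `B(𝒢)`: "the vertices (resp. edges)
of `𝔾'` that lie over `v` (resp. `e`) correspond to the connected components of `S_v` (resp. `T_e`)")
and Def. 2.4 (iii) p. 25 (a closed edge `e` is *sub-coverticial* if some finite étale covering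
`𝒢' → 𝒢` has two distinct coverticial edges over `e`). [cite: MochizukiSemiAnbd2006, Def. 2.4(iii) p.25]

PROOF-ONLY (cell abc-iut, layer L3, row G31 (3) = [SemiAnbd] Ex. 2.10 conjunct (3), seat
abc-iut-w5-d195; no definition).  The purely combinatorial half of the sub-coverticiality argument:

* `SemiGraphOfAnabelioids.BObj.isSubCoverticial_of_components` — if EVERY vertex constituent `S_v` of
  `A` has exactly one connected component (so `𝒢_A` has one vertex over each vertex of `𝒢`) and the
  edge constituent `T_e` of a CLOSED edge `e` has two distinct components `Q₁ ≠ Q₂`, then `e` is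
  sub-coverticial: in print's covering `𝒢_A → 𝒢` (`BObj.coveringGraph` / `BObj.coveringHom`, abc-iut-L3-t5,
  with all four clauses by `BObj.coveringHom_isFiniteEtaleCoveringGlobal`, abc-iut-w4-d071) the edges
  `(e, Q₁) ≠ (e, Q₂)` are closed (`vertCard_total`) and each of their branches abuts to THE vertex of
  `𝒢_A` over the corresponding vertex of `𝒢`, so they abut to the same vertices — they are coverticial.

The group-theoretic half (an object with transitive vertex fibres and a split edge fibre, for `𝒢` of
surface type) is `SurfaceTypeSubCoverticialObject.lean`.
-/

namespace Literature.AnabelianGeometry.SemiGraphs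

open CategoryTheory
open Literature.AnabelianGeometry.Anabelioids

universe v₁ u₁ u

/-! ### The coincidence maps of the total semi-graph of fibre data -/

namespace SemiGraph.FibreData

variable {G : SemiGraph.{u}} (D : G.FibreData)

/-- In the total semi-graph, the decorated branch `(b, d)` abuts to `(v, σ_b d)` when `b` abuts to `v`.
[cite: MochizukiSemiAnbd2006, Def. 2.2(i) p.23] -/
theorem total_abuts_of_abuts {b : G.Branch} {v : G.Vertex} (h : G.abuts b = some v)
    (d : D.FE (G.edgeOf b)) : D.total.abuts ⟨b, d⟩ = some ⟨v, D.σ b v h d⟩ := by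
  change (G.abuts b).pbind _ = _
  simp only [h, Option.pbind_some]
  rfl

/-- A decorated branch abuts only over a vertex its underlying branch abuts to.
[cite: MochizukiSemiAnbd2006, Def. 2.2(i) p.23] -/
theorem abuts_of_total_abuts {bc : D.total.Branch} {vc : D.total.Vertex}
    (h : D.total.abuts bc = some vc) : G.abuts bc.1 = some vc.1 :=
  D.proj.abuts_branchMap bc vc h

end SemiGraph.FibreData

namespace SemiGraphOfAnabelioids

namespace BObj

variable {𝒢 : SemiGraphOfAnabelioids.{v₁, u₁, u}} (A : 𝒢.BObj)

/-- Over a vertex whose constituent `S_v` has one component, the covering `𝒢_A` has exactly one vertex: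
its fibre type is a subsingleton. [cite: MochizukiSemiAnbd2006, Def. 2.2(i) p.23] -/
theorem subsingleton_fibreVertex (v : 𝒢.graph.Vertex) [Subsingleton (π₀Obj (A.S v))] :
    Subsingleton (A.fibreData.FV v) :=
  (equivShrink (π₀Obj (A.S v))).symm.subsingleton

/-- In `𝒢_A`, if every `S_v` has one component, two branches decorating the same branch `b` of `𝒢`
abut to the same vertex. [cite: MochizukiSemiAnbd2006, Def. 2.2(i) p.23] -/
theorem edgeAbuts_of_edgeAbuts (hV : ∀ v, Subsingleton (π₀Obj (A.S v))) {e : 𝒢.graph.Edge}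
    (c c' : A.fibreData.FE e) {vc : A.fibreData.total.Vertex}
    (h : A.fibreData.total.EdgeAbuts ⟨e, c⟩ vc) : A.fibreData.total.EdgeAbuts ⟨e, c'⟩ vc := by
  obtain ⟨⟨b, d⟩, hbe, hab⟩ := h
  have hb : 𝒢.graph.edgeOf b = e := congrArg Sigma.fst hbe
  subst hb
  obtain ⟨v, p⟩ := vc
  have hgb : 𝒢.graph.abuts b = some v := A.fibreData.abuts_of_total_abuts hab
  haveI := hV v
  haveI := A.subsingleton_fibreVertex v
  refine ⟨⟨b, c'⟩, rfl, ?_⟩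
  rw [A.fibreData.total_abuts_of_abuts hgb c']
  congr 1
  exact Sigma.ext rfl (heq_of_eq (Subsingleton.elim _ _))

/-- **Sub-coverticiality from components.**  If every vertex constituent `S_v` of `A ∈ B(𝒢)` has
exactly one connected component and the constituent `T_e` of a closed edge `e` has two distinct
components `Q₁ ≠ Q₂`, then `e` is sub-coverticial: the edges `(e, Q₁)`, `(e, Q₂)` of print's finite
étale covering `𝒢_A → 𝒢` are distinct, closed, and abut to the same vertices.
[cite: MochizukiSemiAnbd2006, Def. 2.4(iii) p.25] -/
theorem isSubCoverticial_of_components (hV : ∀ v, Subsingleton (π₀Obj (A.S v)))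
    {e : 𝒢.graph.Edge} (he : 𝒢.graph.IsClosedEdge e) (Q₁ Q₂ : π₀Obj (A.T e)) (hQ : Q₁ ≠ Q₂) :
    𝒢.IsSubCoverticial e := by
  classical
  refine ⟨he, A.coveringGraph, A.coveringHom, A.coveringHom_isFiniteEtaleCoveringGlobal,
    ⟨e, equivShrink _ Q₁⟩, ⟨e, equivShrink _ Q₂⟩, fun h => hQ ?_, ⟨?_, ?_, fun vc => ?_⟩, rfl, rfl⟩
  · exact (equivShrink _).injective (eq_of_heq (Sigma.mk.inj_iff.mp h).2)
  · change A.fibreData.total.vertCard _ = 2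
    rw [A.fibreData.vertCard_total]; exact he
  · change A.fibreData.total.vertCard _ = 2
    rw [A.fibreData.vertCard_total]; exact he
  · exact ⟨A.edgeAbuts_of_edgeAbuts hV _ _, A.edgeAbuts_of_edgeAbuts hV _ _⟩

end BObj

end SemiGraphOfAnabelioids

end Literature.AnabelianGeometry.SemiGraphs
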